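import Summits.QuantumFields.BalabanUV.T4Continuum.Support.NE7MinActHessianLagrangian
import Summits.QuantumFields.BalabanUV.T4Continuum.Support.NE7StabiliserLifting
import HarnessLib

/-!
# NE7MinActHessianLagrangianAllData — THE MULTIPLIER IDENTITY AND THE BORDERED HESSIAN OF THE CONSTRAINED MINIMAL ACTION AT EVERY SMALL DATUM, UNCONDITIONALLY (ROAD-G115 §5 (iii))

For `d = 4`, every `U(n)`, every `L ≥ 2`: `∃ ε₀ > 0, ∀ 0 < ε ≤ ε₀, ∀ N ≥ 1, ∀ j, ∃ δ_V > 0` such that for EVERY unitary `N`-periodic `δ_V`-small datum `V₀` and EVERY minimiser `U♯` of the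
`(j+1)`-fold constrained problem over `V₀` (with `𝒜 = fineAction∘chart_{U♯}`, `𝒢 = levelQ∘chart_{U♯}` on `skewSub M`, `m = minAct∘chart_{V₀}`, `Q′ = levelQ′ L N j U♯`, `w = stepWt⁻ʲ⁻¹`):
(1) **`multiplier_eq_fderiv_minAct_allData`**: `w·D𝒜(0)[Z] = Dm(0)[Q′Z]` for every fine direction `Z` (the Lagrange multiplier is `w⁻¹·Dm(0)`), and `D𝒜(0)` vanishes on `ker Q′`;
(2) **`minAct_hessian_lagrangian_allData`**: `m` is `C²` at `0` and `D²m(0)[v,v]` is the LEAST element of `{ w·D²𝒜(0)[X,X] − Dm(0)[D²𝒢(0)[X,X]] : X ∈ skewSub M, Q′X = v }` — the Hessian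
of the effective action around the background `U_{j+1}(V₀)` is the constrained minimum of the Hessian of the Lagrangian `𝒜 − λ∘𝒢`.  No genericity ∕ stabiliser hypothesis.
MECHANISM: ✓ `NE7MinActMultiplier` and ✓ `NE7MinActHessianLagrangian` (under the lift hypothesis (G3′)) + ✓ p824904 `NE7StabiliserLifting.stabiliser_lifting` (row NE7b) + existence of
minimisers (`thresholds`).
Cell `pub-balaban`, rung (B)+1 sub-cell t4, lineage `b2b-balaban-t4-ne7-p1` (CRUX PROVER NE7 #1 = OWNER of BINDER row NE7), generation 115.  Memo `t4/b2b-balaban-t4-ne7-p1-g115/ROAD-G115.md` §5.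
WHAT ([folklore]; 0 def, 0 sorry; `d = 4`, every `U(n)`, `L ≥ 2`).  HONEST FRAMING (page 1): composition of landed kernel theorems; QUANTIFIERS `∀ j ∃ δ_V` (row NE7b's level-dependent lifting
radius); radii existential; germs at each datum; VARIATIONAL characterisation only (no operator formula, no spectral bounds, no `k`-uniformity); OUR minimisers (B11 (8) with `sfClass`);
nothing of Bałaban's asserted; NOT NE7 as a spine node, NOT NE3; spine 0∕9; finite T⁴ rung (B)+1 — NOT infinite volume, NOT mass gap, NOT BetaPertH, NOT Clay.
-/

set_option autoImplicit false

open scoped BigOperators Matrix Matrix.Norms.L2Operator Topology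
open NormedSpace Finset Set Filter Metric

namespace Summit.QuantumFields.BalabanUV.T4Continuum.NE7MinActHessianLagrangianAllData

open Literature.MathematicalPhysics.QuantumFieldTheory.Balaban1983to89
open B7Prop1Explicit B7Prop2Explicit
open T4AveragingDeficitWall (IsUnitaryCfg SmallField fineAction)
open T4AveragingDeficitWallBoundary (IsPeriodicCfg)
open AveragingDeficitTorusChart (TDir chart)
open AveragingDeficitTwoLevelPrep (skewSub)
open AveragingDeficitMultiLevelPrep (tower levelQ levelQ')
open MinimalActionLevels (perWin stepWt)
open MinimalActionSandwich (IsMinimiser minAct)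
open MinimalActionRate (sfClass)
open NE3EnergyShapes (IsUnitarySite IsPeriodicSite)
open NE7MinimalOrbitDatumContinuity (thresholds)
open NE7MinActMultiplier (multiplier_eq_fderiv_minAct_of_lift)
open NE7MinActHessianLagrangian (minAct_hessian_lagrangian_of_lift)
open NE7StabiliserLifting (stabiliser_lifting)

noncomputable section

variable {n : Type} [Fintype n] [DecidableEq n]

/-- **THE MULTIPLIER IDENTITY AT EVERY SMALL DATUM, UNCONDITIONALLY** (see the module docstring). [folklore] -/
theorem multiplier_eq_fderiv_minAct_allData [Nonempty n] {L : ℕ} [NeZero L] (hL : 2 ≤ L) :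
    ∃ ε₀ : ℝ, 0 < ε₀ ∧ ∀ ε : ℝ, 0 < ε → ε ≤ ε₀ → ∀ (N : ℕ) [NeZero N], 1 ≤ N → ∀ j : ℕ,
      ∃ δV : ℝ, 0 < δV ∧
        ∀ V₀ ∈ {V : Site 4 → Fin 4 → (Matrix n n ℂ)ˣ | IsUnitaryCfg V ∧ IsPeriodicCfg V (N : ℤ) ∧ SmallField V δV},
        ∀ Us : Site 4 → Fin 4 → (Matrix n n ℂ)ˣ, IsMinimiser 4 (sfClass 4 L N ε) L N (j + 1) V₀ Us →
        (∀ Z : ↥(skewSub 4 n (L * tower L N j)), levelQ' L N j Us (Z : TDir 4 n (L * tower L N j)) = 0 → fderiv ℝ (fun Φ : ↥(skewSub 4 n (L * tower L N j)) => fineAction (chart (ContinuousLinearMap.id ℝ (Matrix n n ℂ)) (L * tower L N j) Us (Φ : TDir 4 n (L * tower L N j))) (perWin 4 (N * L ^ (j + 1)))) 0 Z = 0) ∧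
        ∀ Z : ↥(skewSub 4 n (L * tower L N j)),
          ((stepWt 4 L)⁻¹) ^ (j + 1) * fderiv ℝ (fun Φ : ↥(skewSub 4 n (L * tower L N j)) => fineAction (chart (ContinuousLinearMap.id ℝ (Matrix n n ℂ)) (L * tower L N j) Us (Φ : TDir 4 n (L * tower L N j))) (perWin 4 (N * L ^ (j + 1)))) 0 Z = fderiv ℝ (fun y : ↥(skewSub 4 n N) => minAct 4 (sfClass 4 L N ε) L N (j + 1) (chart (ContinuousLinearMap.id ℝ (Matrix n n ℂ)) N V₀ (y : TDir 4 n N))) 0 (levelQ' L N j Us (Z : TDir 4 n (L * tower L N j))) := by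
  obtain ⟨ε₂, hε₂, H2⟩ := multiplier_eq_fderiv_minAct_of_lift (n := n) hL
  obtain ⟨ε₃, hε₃, H3⟩ := stabiliser_lifting (n := n) hL
  refine ⟨min ε₂ ε₃, lt_min hε₂ hε₃, fun ε hε hεle N _ hN j => ?_⟩
  obtain ⟨δ₂, hδ₂, hM⟩ := H2 ε hε (hεle.trans (min_le_left _ _)) N hN
  obtain ⟨δ₃, hδ₃, hlift⟩ := H3 ε hε (hεle.trans (min_le_right _ _)) N hN (j + 1)
  refine ⟨min δ₂ δ₃, lt_min hδ₂ hδ₃, fun V₀ hV₀ Us hUs => ?_⟩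
  obtain ⟨hV₀u, hV₀P, hV₀δ⟩ := hV₀
  exact hM V₀ ⟨hV₀u, hV₀P, MinimalActionRate.SmallField.mono hV₀δ (min_le_left _ _)⟩ j Us hUs
    fun s hsu hsP hsfix => hlift V₀ ⟨hV₀u, hV₀P, MinimalActionRate.SmallField.mono hV₀δ (min_le_right _ _)⟩ Us hUs s hsu hsP hsfix

/-- **THE BORDERED HESSIAN AT EVERY SMALL DATUM, UNCONDITIONALLY** (see the module docstring). [folklore] -/
theorem minAct_hessian_lagrangian_allData [Nonempty n] {L : ℕ} [NeZero L] (hL : 2 ≤ L) :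
    ∃ ε₀ : ℝ, 0 < ε₀ ∧ ∀ ε : ℝ, 0 < ε → ε ≤ ε₀ → ∀ (N : ℕ) [NeZero N], 1 ≤ N → ∀ j : ℕ,
      ∃ δV : ℝ, 0 < δV ∧
        ∀ V₀ ∈ {V : Site 4 → Fin 4 → (Matrix n n ℂ)ˣ | IsUnitaryCfg V ∧ IsPeriodicCfg V (N : ℤ) ∧ SmallField V δV},
        (∃ Us : Site 4 → Fin 4 → (Matrix n n ℂ)ˣ, IsMinimiser 4 (sfClass 4 L N ε) L N (j + 1) V₀ Us) ∧
        ∀ Us : Site 4 → Fin 4 → (Matrix n n ℂ)ˣ, IsMinimiser 4 (sfClass 4 L N ε) L N (j + 1) V₀ Us →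
        ContDiffAt ℝ 2 (fun y : ↥(skewSub 4 n N) => minAct 4 (sfClass 4 L N ε) L N (j + 1) (chart (ContinuousLinearMap.id ℝ (Matrix n n ℂ)) N V₀ (y : TDir 4 n N))) 0 ∧
        ∀ v : ↥(skewSub 4 n N),
          IsLeast {q : ℝ | ∃ X : ↥(skewSub 4 n (L * tower L N j)), levelQ' L N j Us (X : TDir 4 n (L * tower L N j)) = v ∧
              q = ((stepWt 4 L)⁻¹) ^ (j + 1) * fderiv ℝ (fderiv ℝ (fun Φ : ↥(skewSub 4 n (L * tower L N j)) => fineAction (chart (ContinuousLinearMap.id ℝ (Matrix n n ℂ)) (L * tower L N j) Us (Φ : TDir 4 n (L * tower L N j))) (perWin 4 (N * L ^ (j + 1))))) 0 X X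
                  - fderiv ℝ (fun y : ↥(skewSub 4 n N) => minAct 4 (sfClass 4 L N ε) L N (j + 1) (chart (ContinuousLinearMap.id ℝ (Matrix n n ℂ)) N V₀ (y : TDir 4 n N))) 0 (fderiv ℝ (fderiv ℝ (fun Φ : ↥(skewSub 4 n (L * tower L N j)) => levelQ L N j Us (chart (ContinuousLinearMap.id ℝ (Matrix n n ℂ)) (L * tower L N j) Us (Φ : TDir 4 n (L * tower L N j))))) 0 X X)}
            (fderiv ℝ (fderiv ℝ (fun y : ↥(skewSub 4 n N) => minAct 4 (sfClass 4 L N ε) L N (j + 1) (chart (ContinuousLinearMap.id ℝ (Matrix n n ℂ)) N V₀ (y : TDir 4 n N)))) 0 v v) := by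
  obtain ⟨ε₁, hε₁, H⟩ := thresholds (n := n) hL
  obtain ⟨ε₂, hε₂, H2⟩ := minAct_hessian_lagrangian_of_lift (n := n) hL
  obtain ⟨ε₃, hε₃, H3⟩ := stabiliser_lifting (n := n) hL
  refine ⟨min ε₁ (min ε₂ ε₃), lt_min hε₁ (lt_min hε₂ hε₃), fun ε hε hεle N _ hN j => ?_⟩
  obtain ⟨-, -, -, H1⟩ := H ε hε (hεle.trans (min_le_left _ _))
  obtain ⟨δ₁, hδ₁, hint₁⟩ := H1 N hN
  obtain ⟨δ₂, hδ₂, hB⟩ := H2 ε hε (hεle.trans ((min_le_right _ _).trans (min_le_left _ _))) N hN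
  obtain ⟨δ₃, hδ₃, hlift⟩ := H3 ε hε (hεle.trans ((min_le_right _ _).trans (min_le_right _ _))) N hN (j + 1)
  refine ⟨min δ₁ (min δ₂ δ₃), lt_min hδ₁ (lt_min hδ₂ hδ₃), fun V₀ hV₀ => ?_⟩
  obtain ⟨hV₀u, hV₀P, hV₀δ⟩ := hV₀
  have hV₀1 : V₀ ∈ {V : Site 4 → Fin 4 → (Matrix n n ℂ)ˣ | IsUnitaryCfg V ∧ IsPeriodicCfg V (N : ℤ) ∧ SmallField V δ₁} :=
    ⟨hV₀u, hV₀P, MinimalActionRate.SmallField.mono hV₀δ (min_le_left _ _)⟩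
  have hV₀2 : V₀ ∈ {V : Site 4 → Fin 4 → (Matrix n n ℂ)ˣ | IsUnitaryCfg V ∧ IsPeriodicCfg V (N : ℤ) ∧ SmallField V δ₂} :=
    ⟨hV₀u, hV₀P, MinimalActionRate.SmallField.mono hV₀δ ((min_le_right _ _).trans (min_le_left _ _))⟩
  have hV₀3 : V₀ ∈ {V : Site 4 → Fin 4 → (Matrix n n ℂ)ˣ | IsUnitaryCfg V ∧ IsPeriodicCfg V (N : ℤ) ∧ SmallField V δ₃} :=
    ⟨hV₀u, hV₀P, MinimalActionRate.SmallField.mono hV₀δ ((min_le_right _ _).trans (min_le_right _ _))⟩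
  refine ⟨?_, fun Us hUs => ?_⟩
  · obtain ⟨U₀, hU₀, -⟩ := hint₁ V₀ hV₀1 (j + 1)
    exact ⟨U₀, hU₀⟩
  · exact hB V₀ hV₀2 j Us hUs fun s hsu hsP hsfix => hlift V₀ hV₀3 Us hUs s hsu hsP hsfix

end

end Summit.QuantumFields.BalabanUV.T4Continuum.NE7MinActHessianLagrangianAllData
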